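import Mathlib
import HarnessLib
import Literature.Analysis.FluidPDE.EulerDecayUniqueness
import Summits.NavierStokesRegularity.NavierStokesRegularity.Theorems.PoloidalWindowDoorPoloidalWindowRigidityWeightedIBP
import Summits.NavierStokesRegularity.NavierStokesRegularity.Theorems.PoloidalWindowDoorPoloidalWindowRigidityWeightedYoung
import Summits.NavierStokesRegularity.NavierStokesRegularity.Theorems.PoloidalWindowDoorPoloidalWindowRigidityHorizontalConvolution

/-!
# Theorem A: the weighted reverse Poincaré inequality from a reproduction identity

Seat ns-poloidal-K2-p2 g6 (interim lead-of-record on crux K2 `PoloidalWindowRigidity` = stmt-NavierStokesRegularity-19708;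
line `mixed_type` v1; item stmt-20428 `LrcModEntire`).  File 4b of the Lean port of **Theorem A** of memo
TH-ELLIPTIC-LIOUVILLE-g6.  ABSTRACT STATEMENT (no Fourier analysis here): let `φ ∈ C¹ ∩ L¹` be a real kernel on a
finite-dimensional inner product space `E` (`dim E < 4`) admitting a **reproduction identity**

  `φ(x) = ∑_j ∫ K_j(y) ∂_{b_j} φ(x − y) dy`   (`‖b_j‖ ≤ 1`, `K_j ∈ L¹`, `∫ |K_j| (1 + ‖y‖²)² < ∞`).

Then for every `σ ≥ 1` and every bounded `C¹` function `g` with bounded derivative, `u := g ⋆ φ` (`hconv g φ`) obeys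

* `reversePoincare_of_reproducing` — `∫ u² ρ_σ ≤ C ∫ ‖∇u‖² ρ_σ`, `C = |ι| ∑_j 4 ‖K_j‖₁ ‖K_j (1+‖·‖²)²‖₁` (σ-, g-free).

Proof: the identity passes to `u` (Fubini + the integration by parts `∫ φ ∂g(z−·) = ∫ ∂φ g(z−·)`,
`integral_mul_fderiv_eq_neg_fderiv_mul_of_integrable`), so `|u(x)| ≤ ∑_j ∫ |K_j(y)| ‖∇u(x−y)‖ dy`, and File 3
(`integral_convSq_mul_weight_le`) bounds each weighted square.  This is exactly hypothesis `hrev` of File 5b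
(`…ThmAAssembly.hconv_eq_zero_of_reversePoincare`); File 4a′ (`…RealKernels.kerφ_eq_sum`) supplies the identity for
the annular kernels `φ_{ε,N}`.
WHAT THIS IS NOT: not a claim about Navier–Stokes — analysis plumbing for a kinematic Liouville mechanism (bears_on
LADDER-NS N0 via crux K2 = stmt-19708 / item 20428, mixed_type `stub_semiElliptic` ∩ (TH)).
-/

-- the summit and its single sub-problem share the name (CONVENTIONS §1)
set_option linter.dupNamespace false

noncomputable section

namespace Summit.NavierStokesRegularity.NavierStokesRegularity.Theorems.PoloidalWindowDoorPoloidalWindowRigidityReversePoincare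

open Set Function Filter Topology MeasureTheory InnerProductSpace
open scoped RealInnerProductSpace
open Summit.NavierStokesRegularity.NavierStokesRegularity.Theorems.PoloidalWindowDoorPoloidalWindowRigidityWeightedIBP
open Summit.NavierStokesRegularity.NavierStokesRegularity.Theorems.PoloidalWindowDoorPoloidalWindowRigidityWeightedYoung
open Summit.NavierStokesRegularity.NavierStokesRegularity.Theorems.PoloidalWindowDoorPoloidalWindowRigidityHorizontalConvolution

variable {E : Type*} [NormedAddCommGroup E] [InnerProductSpace ℝ E] [FiniteDimensional ℝ E]
  [MeasurableSpace E] [BorelSpace E]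

/-! ### Moving the derivative from the field to the kernel -/

/-- `∫ φ(s) ∂_v g(z − s) ds = ∫ ∂_vφ(s) g(z − s) ds` for `φ ∈ C¹ ∩ L¹` with `∂_vφ ∈ L¹` and `g ∈ C¹_b`. [folklore] -/
theorem integral_mul_fderiv_shift_eq {φ g : E → ℝ} (hφi : Integrable φ) (hφd : Differentiable ℝ φ)
    {v : E} (hφ'i : Integrable fun s => fderiv ℝ φ s v)
    (hg : ContDiff ℝ 1 g) {M : ℝ} (hg0 : ∀ x, ‖g x‖ ≤ M) (hg1 : ∀ x, ‖fderiv ℝ g x‖ ≤ M) (z : E) :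
    ∫ s, φ s * fderiv ℝ g (z - s) v = ∫ s, fderiv ℝ φ s v * g (z - s) := by
  have hgd : Differentiable ℝ g := hg.differentiable one_ne_zero
  have hgc : Continuous g := hg.continuous
  have hDgc : Continuous (fderiv ℝ g) := hg.continuous_fderiv one_ne_zero
  have hsub : Continuous fun s : E => z - s := continuous_const.sub continuous_id
  have hder : ∀ s, HasFDerivAt (fun s => g (z - s))
      ((fderiv ℝ g (z - s)).comp (-ContinuousLinearMap.id ℝ E)) s := fun s =>
    ((hgd (z - s)).hasFDerivAt).comp s ((hasFDerivAt_id s).const_sub z)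
  have hfd : ∀ s, fderiv ℝ (fun s => g (z - s)) s v = -fderiv ℝ g (z - s) v := by
    intro s
    rw [(hder s).fderiv]
    simp
  have h := integral_mul_fderiv_eq_neg_fderiv_mul_of_integrable (μ := (volume : Measure E)) (f := φ)
    (g := fun s => g (z - s)) (v := v) ?_ ?_ ?_ (fun x _ => hφd x) (fun x _ => (hder x).differentiableAt)
  · simp_rw [hfd] at h
    simp only [mul_neg, integral_neg, neg_inj] at h
    exact h
  · exact hφ'i.mul_bdd (hgc.comp hsub).aestronglyMeasurable (Eventually.of_forall fun x => hg0 _)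
  · simp_rw [hfd]
    refine hφi.mul_bdd (c := M * ‖v‖) ((hDgc.comp hsub).clm_apply continuous_const).neg.aestronglyMeasurable
      (Eventually.of_forall fun x => ?_)
    rw [norm_neg]
    exact (ContinuousLinearMap.le_opNorm _ _).trans (mul_le_mul_of_nonneg_right (hg1 _) (norm_nonneg _))
  · exact hφi.mul_bdd (hgc.comp hsub).aestronglyMeasurable (Eventually.of_forall fun x => hg0 _)

/-! ### The reproduction identity passes to `u = g ⋆ φ` -/

/-- If `φ(x) = ∑_j ∫ K_j(y) ∂_{b_j}φ(x−y) dy` then `u = g ⋆ φ` satisfies `u(x) = ∑_j ∫ K_j(y) ∂_{b_j}u(x−y) dy`. -/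
theorem hconv_eq_sum {ι : Type*} [Fintype ι] (b : ι → E)
    {φ : E → ℝ} (hφi : Integrable φ) (hφd : Differentiable ℝ φ)
    (hφ'i : ∀ j, Integrable fun s => fderiv ℝ φ s (b j))
    {K : ι → E → ℝ} (hKi : ∀ j, Integrable (K j))
    (hrep : ∀ x, φ x = ∑ j, ∫ y, K j y * fderiv ℝ φ (x - y) (b j))
    {g : E → ℝ} (hg : ContDiff ℝ 1 g) {M : ℝ} (hg0 : ∀ x, ‖g x‖ ≤ M) (hg1 : ∀ x, ‖fderiv ℝ g x‖ ≤ M) (x : E) :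
    hconv g φ x = ∑ j, ∫ y, K j y * fderiv ℝ (hconv g φ) (x - y) (b j) := by
  have hgc : Continuous g := hg.continuous
  have hDgc : Continuous (fderiv ℝ g) := hg.continuous_fderiv one_ne_zero
  -- Step 0: expand `u x`
  have hu : hconv g φ x = ∫ t, (∑ j, ∫ y, K j y * fderiv ℝ φ (t - y) (b j)) * g (x - t) := by
    unfold hconv
    congr 1
    ext t
    rw [smul_eq_mul, ← hrep t]
  rw [hu]
  -- Step 1: pull the finite sum out
  have hint : ∀ j, Integrable (fun t => (∫ y, K j y * fderiv ℝ φ (t - y) (b j)) * g (x - t)) := by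
    intro j
    have hc : Integrable (fun t => ∫ y, K j y * fderiv ℝ φ (t - y) (b j)) := by
      have := (hKi j).integrable_convolution (ContinuousLinearMap.mul ℝ ℝ) (hφ'i j)
      refine this.congr (Eventually.of_forall fun t => ?_)
      simp [MeasureTheory.convolution_def]
    exact hc.mul_bdd (hgc.comp (continuous_const.sub continuous_id)).aestronglyMeasurable
      (Eventually.of_forall fun t => hg0 _)
  rw [show (fun t => (∑ j, ∫ y, K j y * fderiv ℝ φ (t - y) (b j)) * g (x - t))
      = fun t => ∑ j, (∫ y, K j y * fderiv ℝ φ (t - y) (b j)) * g (x - t) from funext fun t => Finset.sum_mul _ _ _,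
    integral_finsetSum _ fun j _ => hint j]
  refine Finset.sum_congr rfl fun j _ => ?_
  -- Step 2: Fubini for the `j`-th term
  have hprod : Integrable (fun p : E × E => K j p.2 * fderiv ℝ φ (p.1 - p.2) (b j) * g (x - p.1))
      ((volume : Measure E).prod volume) := by
    have h1 : Integrable (fun p : E × E => K j p.2 * fderiv ℝ φ (p.1 - p.2) (b j))
        ((volume : Measure E).prod volume) := by
      have := (hKi j).convolution_integrand (ContinuousLinearMap.mul ℝ ℝ) (hφ'i j)
        (μ := (volume : Measure E)) (ν := volume)
      simpa using this
    exact h1.mul_bdd ((hgc.comp (continuous_const.sub continuous_fst)).aestronglyMeasurable)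
      (Eventually.of_forall fun p => hg0 _)
  calc ∫ t, (∫ y, K j y * fderiv ℝ φ (t - y) (b j)) * g (x - t)
      = ∫ t, ∫ y, K j y * fderiv ℝ φ (t - y) (b j) * g (x - t) := by
        congr 1
        ext t
        rw [← integral_mul_const]
    _ = ∫ y, ∫ t, K j y * fderiv ℝ φ (t - y) (b j) * g (x - t) := integral_integral_swap hprod
    _ = ∫ y, K j y * fderiv ℝ (hconv g φ) (x - y) (b j) := by
        congr 1
        ext y
        simp_rw [mul_assoc]
        rw [integral_const_mul]
        congr 1
        have hs : ∫ t, fderiv ℝ φ (t - y) (b j) * g (x - t) = ∫ s, fderiv ℝ φ s (b j) * g (x - y - s) := by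
          rw [← integral_sub_right_eq_self (fun s => fderiv ℝ φ s (b j) * g (x - y - s)) y]
          congr 1
          ext t
          rw [sub_sub_sub_cancel_right]
        rw [hs, ← integral_mul_fderiv_shift_eq hφi hφd (hφ'i j) hg hg0 hg1 (x - y),
          fderiv_hconv hg hg0 hg1 hφi]
        unfold hconv
        rw [ContinuousLinearMap.integral_apply (integrable_smul_shift hDgc hg1 hφi (x - y)) (b j)]
        simp only [_root_.FunLike.coe_smul, Pi.smul_apply, smul_eq_mul]

/-! ### The reverse Poincaré inequality -/

/-- **THE WEIGHTED REVERSE POINCARÉ INEQUALITY FROM A REPRODUCTION IDENTITY.**  `dim E < 4`; `φ ∈ C¹ ∩ L¹` with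
`∂_{b_j}φ` integrable, `‖b_j‖ ≤ 1`; `K_j` integrable, `∫ |K_j|(1+‖y‖²)² < ∞`;
`φ(x) = ∑_j ∫ K_j(y) ∂_{b_j}φ(x−y) dy`.  Then there is `C` such that for all `σ ≥ 1` and all `g ∈ C¹` with `g, Dg, ∇g`
bounded, `∫ (g ⋆ φ)² ρ_σ ≤ C ∫ ‖∇(g ⋆ φ)‖² ρ_σ`. [folklore] -/
theorem reversePoincare_of_reproducing (hE : Module.finrank ℝ E < 4) {ι : Type*} [Fintype ι]
    (b : ι → E) (hb : ∀ j, ‖b j‖ ≤ 1)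
    {φ : E → ℝ} (hφi : Integrable φ) (hφd : Differentiable ℝ φ)
    (hφ'i : ∀ j, Integrable fun s => fderiv ℝ φ s (b j))
    {K : ι → E → ℝ} (hKi : ∀ j, Integrable (K j))
    (hKw : ∀ j, Integrable fun y => |K j y| * (1 + ‖y‖ ^ 2) ^ 2)
    (hrep : ∀ x, φ x = ∑ j, ∫ y, K j y * fderiv ℝ φ (x - y) (b j)) :
    ∃ C, ∀ σ : ℝ, 1 ≤ σ → ∀ g : E → ℝ, ContDiff ℝ 1 g →
      (∃ M, ∀ x, ‖g x‖ ≤ M ∧ ‖fderiv ℝ g x‖ ≤ M ∧ ‖gradient g x‖ ≤ M) →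
      ∫ x, (hconv g φ x) ^ 2 * weight σ x ≤ C * ∫ x, ‖gradient (hconv g φ) x‖ ^ 2 * weight σ x := by
  haveI : CompleteSpace E := FiniteDimensional.complete ℝ E
  -- the constant
  set A : ι → ℝ := fun j => ∫ y, |(|K j y|)| with hA
  set B : ι → ℝ := fun j => ∫ y, |(|K j y|)| * (1 + ‖y‖ ^ 2) ^ 2 with hB
  refine ⟨Fintype.card ι * ∑ j, 4 * A j * B j, fun σ hσ g hg ⟨M, hM⟩ => ?_⟩
  have hσ0 : 0 < σ := lt_of_lt_of_le one_pos hσ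
  have hg0 : ∀ x, ‖g x‖ ≤ M := fun x => (hM x).1
  have hg1 : ∀ x, ‖fderiv ℝ g x‖ ≤ M := fun x => (hM x).2.1
  have hDgc : Continuous (fderiv ℝ g) := hg.continuous_fderiv one_ne_zero
  set u : E → ℝ := hconv g φ with hu
  set L1 : ℝ := ∫ y, |φ y| with hL1
  -- regularity of `u`
  have hu1 : ContDiff ℝ 1 u := contDiff_one_hconv hg hg0 hg1 hφi
  have hDu : ∀ z, ‖fderiv ℝ u z‖ ≤ M * L1 := by
    intro z
    rw [hu, fderiv_hconv hg hg0 hg1 hφi]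
    exact norm_hconv_le hg1 hφi z
  set G : E → ℝ := fun z => ‖gradient u z‖ with hG
  have hGc : Continuous G := by
    have : Continuous fun z => gradient u z :=
      (InnerProductSpace.toDual ℝ E).symm.continuous.comp (hu1.continuous_fderiv one_ne_zero)
    exact this.norm
  have hGb : ∀ z, ‖G z‖ ≤ M * L1 := fun z => by
    rw [hG, Real.norm_eq_abs, abs_norm, Literature.Analysis.FluidPDE.norm_gradient_eq_norm_fderiv_real]; exact hDu z
  have hGb' : ∀ z, |G z| ≤ M * L1 := fun z => by rw [← Real.norm_eq_abs]; exact hGb z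
  -- Step 1: the identity for `u` and the pointwise bound `|u x| ≤ ∑_j (|K_j| ⋆ G)(x)`
  set a : ι → E → ℝ := fun j x => ∫ y, |K j y| * G (x - y) with ha
  have hid := hconv_eq_sum b hφi hφd hφ'i hKi hrep hg hg0 hg1
  have hpt : ∀ x, |u x| ≤ ∑ j, a j x := by
    intro x
    rw [hu, hid x]
    refine (Finset.abs_sum_le_sum_abs _ _).trans (Finset.sum_le_sum fun j _ => ?_)
    rw [← Real.norm_eq_abs]
    refine norm_integral_le_of_norm_le ((hKi j).abs.mul_bdd (c := M * L1)
      ((hGc.comp (continuous_const.sub continuous_id)).aestronglyMeasurable)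
      (Eventually.of_forall fun y => hGb _)) (Eventually.of_forall fun y => ?_)
    rw [norm_mul, Real.norm_eq_abs]
    refine mul_le_mul_of_nonneg_left ?_ (abs_nonneg _)
    rw [Real.norm_eq_abs, hG]
    simp only
    rw [Literature.Analysis.FluidPDE.norm_gradient_eq_norm_fderiv_real]
    exact (ContinuousLinearMap.le_opNorm _ _).trans
      (mul_le_of_le_one_right (norm_nonneg (fderiv ℝ u (x - y))) (hb j))
  -- the `a j` are continuous and bounded
  have hac : ∀ j, Continuous (a j) := fun j => by
    have := continuous_hconv (F := ℝ) hGc hGb (hKi j).abs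
    exact this.congr fun x => by simp [hconv, ha, smul_eq_mul]
  have hab : ∀ j x, |a j x| ≤ M * L1 * A j := fun j x => by
    have := norm_hconv_le (F := ℝ) (W := G) hGb (hKi j).abs x
    simpa [hconv, ha, hA, Real.norm_eq_abs] using this
  -- Step 2: `u² ≤ |ι| ∑_j a_j²`
  have hsq : ∀ x, u x ^ 2 ≤ Fintype.card ι * ∑ j, a j x ^ 2 := by
    intro x
    have h1 : u x ^ 2 ≤ (∑ j, a j x) ^ 2 := by
      rw [← sq_abs (u x)]
      exact pow_le_pow_left₀ (abs_nonneg _) (hpt x) 2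
    exact h1.trans (sq_sum_le_card_mul_sum_sq (s := Finset.univ) (f := fun j => a j x))
  -- Step 3: integrate against the weight
  have iρ : Integrable (weight (E := E) σ) := integrable_weight hσ0 hE
  have ia2 : ∀ j, Integrable fun x => a j x ^ 2 * weight σ x := fun j =>
    integrable_of_le_weight hσ0 hE (((hac j).pow 2).mul continuous_weight) (K := (M * L1 * A j) ^ 2) fun x => by
      rw [abs_mul, abs_weight, abs_pow]
      exact mul_le_mul_of_nonneg_right (pow_le_pow_left₀ (abs_nonneg _) (hab j x) 2) (weight_pos σ x).le
  have hstep : ∫ x, u x ^ 2 * weight σ x ≤ ∫ x, (Fintype.card ι * ∑ j, a j x ^ 2) * weight σ x := by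
    refine integral_mono_of_nonneg (Eventually.of_forall fun x => mul_nonneg (sq_nonneg _) (weight_pos σ x).le)
      ?_ (Eventually.of_forall fun x => mul_le_mul_of_nonneg_right (hsq x) (weight_pos σ x).le)
    have : (fun x => (Fintype.card ι * ∑ j, a j x ^ 2) * weight σ x)
        = fun x => (Fintype.card ι : ℝ) * ∑ j, a j x ^ 2 * weight σ x := by
      ext x; rw [mul_assoc, Finset.sum_mul]
    rw [this]
    exact (integrable_finsetSum _ fun j _ => ia2 j).const_mul _
  have hsum : ∫ x, (Fintype.card ι * ∑ j, a j x ^ 2) * weight σ x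
      = Fintype.card ι * ∑ j, ∫ x, a j x ^ 2 * weight σ x := by
    have : (fun x => (Fintype.card ι * ∑ j, a j x ^ 2) * weight σ x)
        = fun x => (Fintype.card ι : ℝ) * ∑ j, a j x ^ 2 * weight σ x := by
      ext x; rw [mul_assoc, Finset.sum_mul]
    rw [this, integral_const_mul, integral_finsetSum _ fun j _ => ia2 j]
  -- Step 4: File 3 on each `a_j`
  have hY : ∀ j, ∫ x, a j x ^ 2 * weight σ x ≤ 4 * A j * B j * ∫ x, G x ^ 2 * weight σ x := by
    intro j
    have hRm : Integrable fun y => |(|K j y|)| * (1 + ‖y‖ ^ 2) ^ 2 := by simpa only [abs_abs] using hKw j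
    have := integral_convSq_mul_weight_le hσ hE (hKi j).abs hRm hGc hGb'
    simpa only [ha] using this
  have hGsq : ∀ x, G x ^ 2 = ‖gradient u x‖ ^ 2 := fun x => rfl
  calc ∫ x, u x ^ 2 * weight σ x
      ≤ Fintype.card ι * ∑ j, ∫ x, a j x ^ 2 * weight σ x := hstep.trans_eq hsum
    _ ≤ Fintype.card ι * ∑ j, 4 * A j * B j * ∫ x, G x ^ 2 * weight σ x :=
        mul_le_mul_of_nonneg_left (Finset.sum_le_sum fun j _ => hY j) (Nat.cast_nonneg _)
    _ = (Fintype.card ι * ∑ j, 4 * A j * B j) * ∫ x, ‖gradient u x‖ ^ 2 * weight σ x := by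
        rw [← Finset.sum_mul, mul_assoc]

end Summit.NavierStokesRegularity.NavierStokesRegularity.Theorems.PoloidalWindowDoorPoloidalWindowRigidityReversePoincare

end
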